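import Literature.NumberTheory.Sieve.SmoothCountWeightedPrimeSum
import Literature.NumberTheory.Sieve.SmoothCountHildebrandIdentity
import HarnessLib

/-!
# The inductive step of Hildebrand's proof of `Ψ(x, y) = xρ(u)(1 + O(·))`

Topic `Literature/NumberTheory/Sieve`; a PROVED tool file toward `Literature.NumberTheory.Sieve.HTLocalBehaviour`
(Hildebrand–Tenenbaum 1986, Theorem 3) in the range of small `u`. We formalize the key inequality of
[Hildebrand1986, §3]: writing `Ψ(t, y) = tρ(log t/log y)(1 + Δ(t))`, Hildebrand's identity
(`HildebrandIdentity.card_mul_log_eq`), the prime number theorem in the form of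
`HildebrandInduction.abs_weightedPrimeSum_sub_le` / `weightedPrimeSum_sqrt_le`, and crude bounds for the
contributions of prime powers and of the logarithmic term give: if `|Δ| ≤ B₁` on `[y, x/2]` and `|Δ| ≤ B₂` on
`[y, x/√y]` (`0 ≤ B₂ ≤ B₁ ≤ 1`), then
`|Δ(x)| ≤ (½ + Cu/log y) B₁ + (½ + Cu/log y) B₂ + Cu/log y` (`u = log x/log y > 2`),
the factor `½` being the relative weight of the primes `p ≤ √y` ("`α(u) ≤ ½`", op. cit.).

* `dickmanRho_sub_le_mul` — `ρ(u - w) ≤ 4u² e^{w log(4u²)} ρ(u)` (`u ≥ 1`, `w ≥ 0`);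
* `sum_exp_neg_mul_dickmanRho_le`, `sum_primePow_weight_le` — the logarithmic term and the prime powers
  weigh `O(u² ρ(u))`;
* `abs_card_sub_model_le_step` — **the inductive inequality**.

## References

* [Hildebrand1986] A. Hildebrand, J. Number Theory 22 (1986) 289–307, §3 (pp. 299–301), Lemmas 2–4.
* [HildebrandTenenbaum1986] A. Hildebrand, G. Tenenbaum, Trans. AMS 296 (1986) 265–290, §1 (1.5).
-/

noncomputable section

open Real Finset ArithmeticFunction

namespace Literature.NumberTheory.Sieve

namespace HildebrandInduction

/-! ### Growth of `ρ` to the left -/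

/-- `ρ(u - n) ≤ (4u²)^n ρ(u)` for `u ≥ 1`. [cite: Hildebrand1986, Lemma 1 (vi)] -/
theorem dickmanRho_sub_nat_le {u : ℝ} (hu : 1 ≤ u) (n : ℕ) :
    dickmanRho (u - n) ≤ (4 * u ^ 2) ^ n * dickmanRho u := by
  induction n with
  | zero => simp
  | succ n ih =>
    have h4 : 1 ≤ 4 * u ^ 2 := by nlinarith
    have hstep : dickmanRho (u - (n + 1 : ℕ)) ≤ 4 * u ^ 2 * dickmanRho (u - n) := by
      rw [Nat.cast_succ, show u - (n + 1 : ℝ) = u - n - 1 by ring]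
      rcases le_or_gt 1 (u - n) with h | h
      · calc dickmanRho (u - n - 1) ≤ 4 * (u - n) ^ 2 * dickmanRho (u - n) := dickmanRho_sub_one_le h
          _ ≤ 4 * u ^ 2 * dickmanRho (u - n) := by
              refine mul_le_mul_of_nonneg_right ?_ (dickmanRho_nonneg _)
              have : 0 ≤ u - n := by linarith
              nlinarith
      · rw [dickmanRho_of_le_one (by linarith), dickmanRho_of_le_one h.le]
        linarith
    calc dickmanRho (u - (n + 1 : ℕ)) ≤ 4 * u ^ 2 * dickmanRho (u - n) := hstep
      _ ≤ 4 * u ^ 2 * ((4 * u ^ 2) ^ n * dickmanRho u) := mul_le_mul_of_nonneg_left ih (by positivity)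
      _ = (4 * u ^ 2) ^ (n + 1) * dickmanRho u := by ring

/-- `ρ(u - w) ≤ 4u² e^{w log(4u²)} ρ(u)` for `u ≥ 1`, `w ≥ 0`. [cite: Hildebrand1986, Lemma 1 (vi)] -/
theorem dickmanRho_sub_le_mul {u w : ℝ} (hu : 1 ≤ u) (hw : 0 ≤ w) :
    dickmanRho (u - w) ≤ 4 * u ^ 2 * Real.exp (w * Real.log (4 * u ^ 2)) * dickmanRho u := by
  set n := ⌈w⌉₊ with hn
  have hwn : w ≤ n := Nat.le_ceil w
  have hnw : (n : ℝ) ≤ w + 1 := by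
    have := Nat.ceil_lt_add_one hw; rw [← hn] at this; linarith
  have h4 : 1 ≤ 4 * u ^ 2 := by nlinarith
  have hlog : 0 ≤ Real.log (4 * u ^ 2) := Real.log_nonneg h4
  calc dickmanRho (u - w) ≤ dickmanRho (u - n) := dickmanRho_antitone (by linarith)
    _ ≤ (4 * u ^ 2) ^ n * dickmanRho u := dickmanRho_sub_nat_le hu n
    _ ≤ 4 * u ^ 2 * Real.exp (w * Real.log (4 * u ^ 2)) * dickmanRho u := by
        refine mul_le_mul_of_nonneg_right ?_ (dickmanRho_nonneg _)
        have h1 : ((4 * u ^ 2) ^ n : ℝ) = Real.exp (n * Real.log (4 * u ^ 2)) := by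
          rw [← Real.rpow_natCast, Real.rpow_def_of_pos (by positivity), mul_comm]
        have h2 : 4 * u ^ 2 * Real.exp (w * Real.log (4 * u ^ 2)) = Real.exp ((w + 1) * Real.log (4 * u ^ 2)) := by
          rw [add_mul, one_mul, Real.exp_add, Real.exp_log (by positivity)]; ring
        rw [h1, h2, Real.exp_le_exp]
        exact mul_le_mul_of_nonneg_right hnw hlog

/-! ### Numerical constants -/

/-- `Σ_{p ≤ y} log p · p^{-3/2} ≤ 6`. [folklore] -/
theorem sum_primesLE_log_mul_rpow_three_halves_le {y : ℕ} (hy : 2 ≤ y) :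
    ∑ p ∈ Nat.primesLE y, Real.log p * (p : ℝ) ^ (-(3 / 2 : ℝ)) ≤ 6 := by
  have h := sum_primesLE_log_mul_rpow_le (σ := 3 / 2) (y := y) (by norm_num) hy
  have hy2 : (2 : ℝ) ≤ y := by exact_mod_cast hy
  have hy0 : (0 : ℝ) < y := by linarith
  have hint : ∫ t in (2 : ℝ)..y, t ^ (-(3 / 2 : ℝ)) ≤ 2 := by
    rw [integral_rpow_neg_eq (by norm_num) hy]
    have h1 : (y : ℝ) ^ (1 - (3 / 2 : ℝ)) ≥ 0 := by positivity
    have h2 : (2 : ℝ) ^ (1 - (3 / 2 : ℝ)) ≤ 1 := Real.rpow_le_one_of_one_le_of_nonpos one_le_two (by norm_num)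
    rw [show (1 : ℝ) - 3 / 2 = -(1 / 2) by norm_num] at h1 h2 ⊢
    rw [div_le_iff_of_neg (by norm_num)]
    linarith
  have hy1 : (y : ℝ) ^ (1 - (3 / 2 : ℝ)) ≤ 1 := Real.rpow_le_one_of_one_le_of_nonpos (by linarith) (by norm_num)
  have hl4 : Real.log 4 ≤ 3 / 2 := by
    have h2 : Real.log 4 = 2 * Real.log 2 := by
      rw [show (4 : ℝ) = 2 ^ 2 by norm_num, Real.log_pow]; norm_num
    have := Real.log_two_lt_d9
    linarith
  have hl40 : 0 ≤ Real.log 4 := Real.log_nonneg (by norm_num)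
  calc ∑ p ∈ Nat.primesLE y, Real.log p * (p : ℝ) ^ (-(3 / 2 : ℝ))
      ≤ Real.log 4 * ((y : ℝ) ^ (1 - (3 / 2 : ℝ)) + 3 / 2 * ∫ t in (2 : ℝ)..y, t ^ (-(3 / 2 : ℝ))) := h
    _ ≤ 3 / 2 * (1 + 3 / 2 * 2) := by
        refine mul_le_mul hl4 (by linarith) ?_ (by norm_num)
        have : 0 ≤ ∫ t in (2 : ℝ)..y, t ^ (-(3 / 2 : ℝ)) :=
          intervalIntegral.integral_nonneg hy2 fun t ht => Real.rpow_nonneg (by linarith [ht.1]) _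
        positivity
    _ = 6 := by norm_num

/-! ### The logarithmic term and the prime powers weigh `O(u² ρ(u))` -/

/-- `Σ_{1 ≤ k ≤ K} e^{-k} ρ(u - k/L) ≤ 8u² ρ(u)` when `2 log(4u²) ≤ L` (`u ≥ 1`). [cite: Hildebrand1986, Lemma 2] -/
theorem sum_exp_neg_mul_dickmanRho_le {u L : ℝ} (K : ℕ) (hu : 1 ≤ u) (hL : 0 < L)
    (hcond : 2 * Real.log (4 * u ^ 2) ≤ L) :
    ∑ k ∈ Finset.Icc 1 K, Real.exp (-(k : ℝ)) * dickmanRho (u - k / L) ≤ 8 * u ^ 2 * dickmanRho u := by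
  have h4 : 1 ≤ 4 * u ^ 2 := by nlinarith
  have hlog : 0 ≤ Real.log (4 * u ^ 2) := Real.log_nonneg h4
  have hc : Real.log (4 * u ^ 2) / L ≤ 1 / 2 := by
    rw [div_le_iff₀ hL]; linarith
  -- `e^{-1/2} ≤ 2/3` (also `Literature.Barriers.Parity.MatomakiMerikoski.exp_neg_one_half_le_two_thirds`)
  have hehalf : Real.exp (-(1 / 2 : ℝ)) ≤ 2 / 3 := by
    have h := Real.add_one_le_exp (1 / 2 : ℝ)
    rw [Real.exp_neg, inv_le_comm₀ (Real.exp_pos _) (by norm_num)]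
    linarith
  set r := Real.exp (-(1 / 2 : ℝ)) with hr
  have hr0 : 0 ≤ r := (Real.exp_pos _).le
  have hr1 : r ≤ 2 / 3 := hehalf
  have hterm : ∀ k ∈ Finset.Icc 1 K, Real.exp (-(k : ℝ)) * dickmanRho (u - k / L) ≤ 4 * u ^ 2 * dickmanRho u * r ^ k := by
    intro k _
    have hk0 : (0 : ℝ) ≤ k := Nat.cast_nonneg k
    have h1 := dickmanRho_sub_le_mul hu (div_nonneg hk0 hL.le : 0 ≤ (k : ℝ) / L)
    have h2 : Real.exp (-(k : ℝ)) * (4 * u ^ 2 * Real.exp ((k : ℝ) / L * Real.log (4 * u ^ 2)) * dickmanRho u) =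
        4 * u ^ 2 * dickmanRho u * Real.exp (-(k : ℝ) * (1 - Real.log (4 * u ^ 2) / L)) := by
      rw [show -(k : ℝ) * (1 - Real.log (4 * u ^ 2) / L) = -(k : ℝ) + (k : ℝ) / L * Real.log (4 * u ^ 2) by
        field_simp; ring, Real.exp_add]
      ring
    have h3 : Real.exp (-(k : ℝ) * (1 - Real.log (4 * u ^ 2) / L)) ≤ r ^ k := by
      rw [hr, ← Real.exp_nat_mul, Real.exp_le_exp]
      nlinarith
    calc Real.exp (-(k : ℝ)) * dickmanRho (u - k / L)
        ≤ Real.exp (-(k : ℝ)) * (4 * u ^ 2 * Real.exp ((k : ℝ) / L * Real.log (4 * u ^ 2)) * dickmanRho u) :=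
          mul_le_mul_of_nonneg_left h1 (Real.exp_pos _).le
      _ = 4 * u ^ 2 * dickmanRho u * Real.exp (-(k : ℝ) * (1 - Real.log (4 * u ^ 2) / L)) := h2
      _ ≤ 4 * u ^ 2 * dickmanRho u * r ^ k :=
          mul_le_mul_of_nonneg_left h3 (by have := dickmanRho_nonneg u; positivity)
  refine (Finset.sum_le_sum hterm).trans ?_
  rw [← Finset.mul_sum]
  have hgeom : ∑ k ∈ Finset.Icc 1 K, r ^ k ≤ 2 := by
    rw [show Finset.Icc 1 K = Finset.Ico 1 (K + 1) by ext k; simp]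
    calc ∑ k ∈ Finset.Ico 1 (K + 1), r ^ k ≤ r ^ 1 / (1 - r) := geom_sum_Ico_le_of_lt_one hr0 (by linarith)
      _ ≤ 2 := by rw [pow_one, div_le_iff₀ (by linarith)]; linarith
  have hρ := dickmanRho_nonneg u
  calc 4 * u ^ 2 * dickmanRho u * ∑ k ∈ Finset.Icc 1 K, r ^ k ≤ 4 * u ^ 2 * dickmanRho u * 2 :=
        mul_le_mul_of_nonneg_left hgeom (by positivity)
    _ = 8 * u ^ 2 * dickmanRho u := by ring

/-- `Σ_{p ≤ y} Σ_{2 ≤ m ≤ M} (log p/p^m) ρ(u - m log p/L) ≤ 72 u² ρ(u)` when `4 log(4u²) ≤ L` (`u ≥ 1`, `y ≥ 2`).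
[cite: Hildebrand1986, Lemma 3] -/
theorem sum_primePow_weight_le {u L : ℝ} {y : ℕ} (M : ℕ) (hu : 1 ≤ u) (hL : 0 < L) (hy : 2 ≤ y)
    (hcond : 4 * Real.log (4 * u ^ 2) ≤ L) :
    ∑ p ∈ Nat.primesLE y, ∑ m ∈ Finset.Icc 2 M, Real.log p / (p : ℝ) ^ m * dickmanRho (u - m * Real.log p / L) ≤
      72 * u ^ 2 * dickmanRho u := by
  have h4 : 1 ≤ 4 * u ^ 2 := by nlinarith
  have hlog : 0 ≤ Real.log (4 * u ^ 2) := Real.log_nonneg h4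
  have hc : Real.log (4 * u ^ 2) / L ≤ 1 / 4 := by
    rw [div_le_iff₀ hL]; linarith
  have hρ := dickmanRho_nonneg u
  have hehalf : Real.exp (-(1 / 2 : ℝ)) ≤ 2 / 3 := by
    have h := Real.add_one_le_exp (1 / 2 : ℝ)
    rw [Real.exp_neg, inv_le_comm₀ (Real.exp_pos _) (by norm_num)]
    linarith
  -- each prime: `Σ_m ≤ 4u²ρ(u) log p Σ_m r_p^m ≤ 4u²ρ(u) · 3 log p · p^{-3/2}`
  have hprime : ∀ p ∈ Nat.primesLE y, ∑ m ∈ Finset.Icc 2 M, Real.log p / (p : ℝ) ^ m * dickmanRho (u - m * Real.log p / L) ≤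
      4 * u ^ 2 * dickmanRho u * (3 * (Real.log p * (p : ℝ) ^ (-(3 / 2 : ℝ)))) := by
    intro p hp
    have hp2 : (2 : ℝ) ≤ p := by exact_mod_cast (Nat.mem_primesLE.1 hp).2.two_le
    have hp0 : (0 : ℝ) < p := by linarith
    have hlp : 0 ≤ Real.log p := Real.log_nonneg (by linarith)
    have hlp2 : Real.log 2 ≤ Real.log p := Real.log_le_log two_pos hp2
    set r := Real.exp (-(3 / 4 * Real.log p)) with hr
    have hr0 : 0 ≤ r := (Real.exp_pos _).le
    have hr1 : r ≤ 2 / 3 := by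
      have : Real.exp (-(3 / 4 * Real.log p)) ≤ Real.exp (-(1 / 2 : ℝ)) := by
        rw [Real.exp_le_exp]; have := Real.log_two_gt_d9; linarith
      exact this.trans hehalf
    have hterm : ∀ m ∈ Finset.Icc 2 M, Real.log p / (p : ℝ) ^ m * dickmanRho (u - m * Real.log p / L) ≤
        4 * u ^ 2 * dickmanRho u * (Real.log p * r ^ m) := by
      intro m _
      have hm0 : (0 : ℝ) ≤ m := Nat.cast_nonneg m
      have hw : 0 ≤ (m : ℝ) * Real.log p / L := by positivity
      have h1 := dickmanRho_sub_le_mul hu hw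
      have hpm : (p : ℝ) ^ m = Real.exp (m * Real.log p) := by
        rw [← Real.rpow_natCast, Real.rpow_def_of_pos hp0, mul_comm]
      have h2 : Real.log p / (p : ℝ) ^ m * (4 * u ^ 2 * Real.exp ((m : ℝ) * Real.log p / L * Real.log (4 * u ^ 2)) * dickmanRho u) =
          4 * u ^ 2 * dickmanRho u * (Real.log p * Real.exp (-(m * Real.log p) * (1 - Real.log (4 * u ^ 2) / L))) := by
        rw [hpm, div_eq_mul_inv, ← Real.exp_neg,
          show -(m * Real.log p) * (1 - Real.log (4 * u ^ 2) / L) = -(m * Real.log p) + (m : ℝ) * Real.log p / L * Real.log (4 * u ^ 2) by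
            field_simp; ring, Real.exp_add]
        ring
      have h3 : Real.exp (-(m * Real.log p) * (1 - Real.log (4 * u ^ 2) / L)) ≤ r ^ m := by
        rw [hr, ← Real.exp_nat_mul, Real.exp_le_exp]
        have : 0 ≤ (m : ℝ) * Real.log p := by positivity
        nlinarith
      calc Real.log p / (p : ℝ) ^ m * dickmanRho (u - m * Real.log p / L)
          ≤ Real.log p / (p : ℝ) ^ m * (4 * u ^ 2 * Real.exp ((m : ℝ) * Real.log p / L * Real.log (4 * u ^ 2)) * dickmanRho u) :=
            mul_le_mul_of_nonneg_left h1 (by positivity)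
        _ = 4 * u ^ 2 * dickmanRho u * (Real.log p * Real.exp (-(m * Real.log p) * (1 - Real.log (4 * u ^ 2) / L))) := h2
        _ ≤ 4 * u ^ 2 * dickmanRho u * (Real.log p * r ^ m) := by
            refine mul_le_mul_of_nonneg_left (mul_le_mul_of_nonneg_left h3 hlp) (by positivity)
    refine (Finset.sum_le_sum hterm).trans ?_
    rw [← Finset.mul_sum, ← Finset.mul_sum]
    refine mul_le_mul_of_nonneg_left ?_ (by positivity)
    have hgeom : ∑ m ∈ Finset.Icc 2 M, r ^ m ≤ 3 * r ^ 2 := by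
      rw [show Finset.Icc 2 M = Finset.Ico 2 (M + 1) by ext k; simp]
      calc ∑ m ∈ Finset.Ico 2 (M + 1), r ^ m ≤ r ^ 2 / (1 - r) := geom_sum_Ico_le_of_lt_one hr0 (by linarith)
        _ ≤ 3 * r ^ 2 := by
            rw [div_le_iff₀ (by linarith)]
            have : 0 ≤ r ^ 2 := sq_nonneg r
            nlinarith
    have hr2 : r ^ 2 = (p : ℝ) ^ (-(3 / 2 : ℝ)) := by
      rw [hr, ← Real.exp_nat_mul, Real.rpow_def_of_pos hp0]
      congr 1; push_cast; ring
    calc Real.log p * ∑ m ∈ Finset.Icc 2 M, r ^ m ≤ Real.log p * (3 * r ^ 2) := mul_le_mul_of_nonneg_left hgeom hlp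
      _ = 3 * (Real.log p * (p : ℝ) ^ (-(3 / 2 : ℝ))) := by rw [hr2]; ring
  refine (Finset.sum_le_sum hprime).trans ?_
  rw [← Finset.mul_sum, ← Finset.mul_sum]
  have h6 := sum_primesLE_log_mul_rpow_three_halves_le hy
  calc 4 * u ^ 2 * dickmanRho u * (3 * ∑ p ∈ Nat.primesLE y, Real.log p * (p : ℝ) ^ (-(3 / 2 : ℝ)))
      ≤ 4 * u ^ 2 * dickmanRho u * (3 * 6) := by
        refine mul_le_mul_of_nonneg_left (by linarith) (by positivity)
    _ = 72 * u ^ 2 * dickmanRho u := by ring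

/-! ### The inductive inequality -/

/-- `log(x/d)/L = u - log d/L` for `log x = uL`. [folklore] -/
theorem log_div_div_eq {x d L u : ℝ} (hx : 0 < x) (hd : 0 < d) (hL : L ≠ 0) (hu : Real.log x = u * L) :
    Real.log (x / d) / L = u - Real.log d / L := by
  rw [Real.log_div hx.ne' hd.ne', hu]; field_simp

set_option maxHeartbeats 1600000 in
/-- **The inductive inequality** [Hildebrand1986, §3]. There is an absolute `C` such that for `y ≥ 4`, `x > 0`
with `u = log x/log y > 2`, `4 log(4u²) ≤ log y`, `Cu ≤ log y`, and `0 ≤ B₂ ≤ B₁ ≤ 1`: if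
`|Ψ(t,y) - tρ(log t/log y)| ≤ B₁ tρ(·)` for `y ≤ t ≤ x/2`, `≤ B₂ tρ(·)` for `y ≤ t ≤ x/√y`, and
`Ψ(t, y) ≤ 2tρ(log t/log y)` for `0 < t ≤ x/2`, then
`|Ψ(x, y) - xρ(u)| ≤ ((B₁ + B₂)/2 + Cu/log y) xρ(u)`.
(Hildebrand's identity; the primes `p ≤ √y` carry weight `≤ ½ u ρ(u) log y + O(ρ(u-1))` and all `p ≤ y`
weight `u ρ(u) log y + O(ρ(u-1))`, `ρ(u-1) ≤ 4u²ρ(u)`; prime powers and the logarithmic term weigh `O(u² xρ(u))`.)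
[cite: Hildebrand1986, §3 (pp. 299–301)] -/
theorem abs_card_sub_model_le_step :
    ∃ C : ℝ, 0 ≤ C ∧ ∀ (y : ℕ) (x B₁ B₂ : ℝ), 4 ≤ y → 0 < x →
      2 < Real.log x / Real.log y →
      4 * Real.log (4 * (Real.log x / Real.log y) ^ 2) ≤ Real.log y →
      C * (Real.log x / Real.log y) ≤ Real.log y →
      0 ≤ B₂ → B₂ ≤ B₁ → B₁ ≤ 1 →
      (∀ t : ℝ, (y : ℝ) ≤ t → t ≤ x / 2 →
        |((Nat.smoothNumbersUpTo ⌊t⌋₊ (y + 1)).card : ℝ) - t * dickmanRho (Real.log t / Real.log y)| ≤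
          B₁ * (t * dickmanRho (Real.log t / Real.log y))) →
      (∀ t : ℝ, (y : ℝ) ≤ t → t ≤ x / Real.sqrt y →
        |((Nat.smoothNumbersUpTo ⌊t⌋₊ (y + 1)).card : ℝ) - t * dickmanRho (Real.log t / Real.log y)| ≤
          B₂ * (t * dickmanRho (Real.log t / Real.log y))) →
      (∀ t : ℝ, 0 < t → t ≤ x / 2 →
        ((Nat.smoothNumbersUpTo ⌊t⌋₊ (y + 1)).card : ℝ) ≤ 2 * (t * dickmanRho (Real.log t / Real.log y))) →
      |((Nat.smoothNumbersUpTo ⌊x⌋₊ (y + 1)).card : ℝ) - x * dickmanRho (Real.log x / Real.log y)| ≤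
        ((B₁ + B₂) / 2 + C * (Real.log x / Real.log y) / Real.log y) *
          (x * dickmanRho (Real.log x / Real.log y)) := by
  obtain ⟨CW, hCW0, hCW⟩ := abs_weightedPrimeSum_sub_le
  obtain ⟨CV, hCV0, hCV⟩ := weightedPrimeSum_sqrt_le
  refine ⟨166 + 8 * CW + 4 * CV, by positivity, ?_⟩
  intro y x B₁ B₂ hy hx0 hu2 hcond hsmall hB₂ hB₂₁ hB₁ IH1 IH2 AP
  -- basic quantities
  have hy4 : (4 : ℝ) ≤ y := by exact_mod_cast hy
  have hy0 : (0 : ℝ) < y := by linarith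
  have hy2 : 2 ≤ y := le_trans (by norm_num) hy
  set L := Real.log y with hL
  have hL1 : 1 < L := by
    rw [hL, Real.lt_log_iff_exp_lt hy0]
    exact lt_of_lt_of_le (Real.exp_one_lt_d9.trans (by norm_num)) hy4
  have hL0 : 0 < L := by linarith
  set u := Real.log x / L with hudef
  have hlogx : Real.log x = u * L := by rw [hudef]; field_simp
  have hu1 : 1 ≤ u := by linarith
  have hu0 : 0 < u := by linarith
  have huL : 2 < u * L := by nlinarith
  have hx1 : 1 ≤ x := by
    have : 0 < Real.log x := by rw [hlogx]; positivity
    by_contra h; push Not at h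
    have := Real.log_nonpos hx0.le h.le; linarith
  have hxy : (y : ℝ) ^ 2 ≤ x := by
    have h1 : Real.log ((y : ℝ) ^ 2) ≤ Real.log x := by
      rw [Real.log_pow, Nat.cast_ofNat, hlogx, ← hL]; nlinarith
    exact (Real.log_le_log_iff (by positivity) hx0).1 h1
  set ρu := dickmanRho u with hρu
  have hρu0 : 0 < ρu := dickmanRho_pos u
  set M₀ := x * ρu with hM₀
  have hM₀0 : 0 < M₀ := mul_pos hx0 hρu0
  have hρ1 : dickmanRho (u - 1) ≤ 4 * u ^ 2 * ρu := dickmanRho_sub_one_le hu1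
  have hρ10 : 0 ≤ dickmanRho (u - 1) := dickmanRho_nonneg _
  have hcond2 : 2 * Real.log (4 * u ^ 2) ≤ L := by
    have : 0 ≤ Real.log (4 * u ^ 2) := Real.log_nonneg (by nlinarith); linarith
  -- Hildebrand's identity and the elementary sandwich
  set Ψx := ((Nat.smoothNumbersUpTo ⌊x⌋₊ (y + 1)).card : ℝ) with hΨx
  have hId := HildebrandIdentity.card_mul_log_eq (y := y) hx1
  have hA0 := HildebrandIdentity.sum_log_div_nonneg (y := y) hx0.le
  have hA1 := HildebrandIdentity.sum_log_div_le (y := y) hx1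
  have hΛlo := HildebrandIdentity.sum_primesLE_le_sum_vonMangoldt (y := y) hx0.le
  have hΛup := HildebrandIdentity.sum_vonMangoldt_le (y := y) hx1
  -- the logarithmic term: `Σ_k Ψ(x/e^k) ≤ 16 u² M₀`
  have hA1b : ∑ k ∈ Finset.Icc 1 ⌊Real.log x⌋₊, ((Nat.smoothNumbersUpTo ⌊x / Real.exp k⌋₊ (y + 1)).card : ℝ) ≤
      16 * u ^ 2 * M₀ := by
    have hterm : ∀ k ∈ Finset.Icc 1 ⌊Real.log x⌋₊, ((Nat.smoothNumbersUpTo ⌊x / Real.exp k⌋₊ (y + 1)).card : ℝ) ≤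
        2 * x * (Real.exp (-(k : ℝ)) * dickmanRho (u - k / L)) := by
      intro k hk
      rw [Finset.mem_Icc] at hk
      have hek : (2 : ℝ) ≤ Real.exp k := by
        have h1 : Real.exp 1 ≤ Real.exp k := Real.exp_le_exp.2 (by exact_mod_cast hk.1)
        have := Real.add_one_le_exp (1 : ℝ); linarith
      have h := AP (x / Real.exp k) (div_pos hx0 (Real.exp_pos _))
        (div_le_div_of_nonneg_left hx0.le two_pos hek)
      have hlog : Real.log (x / Real.exp k) / L = u - k / L := by
        rw [log_div_div_eq hx0 (Real.exp_pos _) hL0.ne' hlogx, Real.log_exp]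
      rw [hlog] at h
      calc _ ≤ 2 * (x / Real.exp k * dickmanRho (u - k / L)) := h
        _ = 2 * x * (Real.exp (-(k : ℝ)) * dickmanRho (u - k / L)) := by rw [Real.exp_neg]; ring
    refine (Finset.sum_le_sum hterm).trans ?_
    rw [← Finset.mul_sum]
    have := sum_exp_neg_mul_dickmanRho_le ⌊Real.log x⌋₊ hu1 hL0 hcond2
    calc 2 * x * ∑ k ∈ Finset.Icc 1 ⌊Real.log x⌋₊, Real.exp (-(k : ℝ)) * dickmanRho (u - k / L)
        ≤ 2 * x * (8 * u ^ 2 * ρu) := mul_le_mul_of_nonneg_left this (by positivity)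
      _ = 16 * u ^ 2 * M₀ := by rw [hM₀]; ring
  -- the prime powers: `Σ_p Σ_{m ≥ 2} log p Ψ(x/p^m) ≤ 144 u² M₀`
  have hPb : ∑ p ∈ Nat.primesLE y, ∑ m ∈ Finset.Icc 2 ⌊Real.log x / Real.log 2⌋₊,
      Real.log p * ((Nat.smoothNumbersUpTo ⌊x / (p : ℝ) ^ m⌋₊ (y + 1)).card : ℝ) ≤ 144 * u ^ 2 * M₀ := by
    have hterm : ∀ p ∈ Nat.primesLE y, ∀ m ∈ Finset.Icc 2 ⌊Real.log x / Real.log 2⌋₊,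
        Real.log p * ((Nat.smoothNumbersUpTo ⌊x / (p : ℝ) ^ m⌋₊ (y + 1)).card : ℝ) ≤
          2 * x * (Real.log p / (p : ℝ) ^ m * dickmanRho (u - m * Real.log p / L)) := by
      intro p hp m hm
      rw [Finset.mem_Icc] at hm
      have hp2 : (2 : ℝ) ≤ p := by exact_mod_cast (Nat.mem_primesLE.1 hp).2.two_le
      have hpm0 : (0 : ℝ) < (p : ℝ) ^ m := by positivity
      have hpm2 : (2 : ℝ) ≤ (p : ℝ) ^ m := by
        calc (2 : ℝ) ≤ 2 ^ m := by
              calc (2 : ℝ) = 2 ^ 1 := by norm_num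
                _ ≤ 2 ^ m := pow_le_pow_right₀ one_le_two (by omega)
          _ ≤ (p : ℝ) ^ m := pow_le_pow_left₀ (by norm_num) hp2 m
      have h := AP (x / (p : ℝ) ^ m) (div_pos hx0 hpm0) (div_le_div_of_nonneg_left hx0.le two_pos hpm2)
      have hlog : Real.log (x / (p : ℝ) ^ m) / L = u - m * Real.log p / L := by
        rw [log_div_div_eq hx0 hpm0 hL0.ne' hlogx, Real.log_pow]
      rw [hlog] at h
      have hlp : 0 ≤ Real.log p := Real.log_nonneg (by linarith)
      calc _ ≤ Real.log p * (2 * (x / (p : ℝ) ^ m * dickmanRho (u - m * Real.log p / L))) :=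
            mul_le_mul_of_nonneg_left h hlp
        _ = 2 * x * (Real.log p / (p : ℝ) ^ m * dickmanRho (u - m * Real.log p / L)) := by ring
    calc _ ≤ ∑ p ∈ Nat.primesLE y, ∑ m ∈ Finset.Icc 2 ⌊Real.log x / Real.log 2⌋₊,
          2 * x * (Real.log p / (p : ℝ) ^ m * dickmanRho (u - m * Real.log p / L)) :=
          Finset.sum_le_sum fun p hp => Finset.sum_le_sum fun m hm => hterm p hp m hm
      _ = 2 * x * ∑ p ∈ Nat.primesLE y, ∑ m ∈ Finset.Icc 2 ⌊Real.log x / Real.log 2⌋₊,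
          Real.log p / (p : ℝ) ^ m * dickmanRho (u - m * Real.log p / L) := by
          rw [Finset.mul_sum]; refine Finset.sum_congr rfl fun p _ => ?_; rw [Finset.mul_sum]
      _ ≤ 2 * x * (72 * u ^ 2 * ρu) :=
          mul_le_mul_of_nonneg_left (sum_primePow_weight_le _ hu1 hL0 hy2 hcond) (by positivity)
      _ = 144 * u ^ 2 * M₀ := by rw [hM₀]; ring
  -- the primes: `Σ_p log p Ψ(x/p) = x W + E`
  set w : ℕ → ℝ := fun p => Real.log p / p * dickmanRho (u - Real.log p / L) with hw
  set W := ∑ p ∈ Nat.primesLE y, w p with hW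
  set P₁ := Nat.primesLE ⌊Real.sqrt y⌋₊ with hP₁
  set W₁ := ∑ p ∈ P₁, w p with hW₁
  have hsub : P₁ ⊆ Nat.primesLE y := by
    intro p hp
    rw [hP₁, Nat.mem_primesLE] at hp
    rw [Nat.mem_primesLE]
    refine ⟨?_, hp.2⟩
    have h1 : (p : ℝ) ≤ Real.sqrt y := le_trans (by exact_mod_cast hp.1) (Nat.floor_le (Real.sqrt_nonneg _))
    have h2 : Real.sqrt y ≤ y := by
      rw [Real.sqrt_le_left hy0.le]; nlinarith
    exact_mod_cast h1.trans h2
  have hw0 : ∀ p ∈ Nat.primesLE y, 0 ≤ w p := by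
    intro p hp
    have hp2 : (2 : ℝ) ≤ p := by exact_mod_cast (Nat.mem_primesLE.1 hp).2.two_le
    have := dickmanRho_nonneg (u - Real.log p / L)
    have : 0 ≤ Real.log p := Real.log_nonneg (by linarith)
    positivity
  have hWsplit : W = W₁ + ∑ p ∈ Nat.primesLE y \ P₁, w p := by
    rw [hW, hW₁, ← Finset.sum_sdiff hsub]; ring
  have hW₂0 : 0 ≤ ∑ p ∈ Nat.primesLE y \ P₁, w p :=
    Finset.sum_nonneg fun p hp => hw0 p (Finset.sdiff_subset hp)
  have hWabs := hCW u y hu2 hy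
  have hW₁b := hCV u y hu2 hy
  rw [← hL] at hWabs hW₁b
  change |W - u * ρu * L| ≤ CW * dickmanRho (u - 1) at hWabs
  change W₁ ≤ u * ρu * L / 2 + CV * dickmanRho (u - 1) at hW₁b
  -- the model at `x/p` and the error `E`
  have hmp : ∀ p ∈ Nat.primesLE y, dickmanRho (Real.log (x / p) / L) = dickmanRho (u - Real.log p / L) ∧
      (y : ℝ) ≤ x / p ∧ x / p ≤ x / 2 := by
    intro p hp
    have hpp := (Nat.mem_primesLE.1 hp)
    have hp2 : (2 : ℝ) ≤ p := by exact_mod_cast hpp.2.two_le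
    have hp0 : (0 : ℝ) < p := by linarith
    have hpy : (p : ℝ) ≤ y := by exact_mod_cast hpp.1
    refine ⟨by rw [log_div_div_eq hx0 hp0 hL0.ne' hlogx], ?_, div_le_div_of_nonneg_left hx0.le two_pos hp2⟩
    rw [le_div_iff₀ hp0]
    calc (y : ℝ) * p ≤ y * y := mul_le_mul_of_nonneg_left hpy hy0.le
      _ = (y : ℝ) ^ 2 := by ring
      _ ≤ x := hxy
  set E := ∑ p ∈ Nat.primesLE y, Real.log p *
      (((Nat.smoothNumbersUpTo ⌊x / p⌋₊ (y + 1)).card : ℝ) - x / p * dickmanRho (u - Real.log p / L)) with hE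
  have hBsum : ∑ p ∈ Nat.primesLE y, Real.log p * ((Nat.smoothNumbersUpTo ⌊x / p⌋₊ (y + 1)).card : ℝ) =
      x * W + E := by
    rw [hE, hW, Finset.mul_sum, ← Finset.sum_add_distrib]
    refine Finset.sum_congr rfl fun p hp => ?_
    have hp0 : (0 : ℝ) < p := by exact_mod_cast (Nat.mem_primesLE.1 hp).2.pos
    rw [hw]; simp only
    field_simp
    ring
  have hEabs : |E| ≤ x * (B₁ * W₁ + B₂ * ∑ p ∈ Nat.primesLE y \ P₁, w p) := by
    have hpt : ∀ p ∈ Nat.primesLE y, |Real.log p *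
        (((Nat.smoothNumbersUpTo ⌊x / p⌋₊ (y + 1)).card : ℝ) - x / p * dickmanRho (u - Real.log p / L))| ≤
        x * ((if p ∈ P₁ then B₁ else B₂) * w p) := by
      intro p hp
      obtain ⟨hρp, hyp, hp2x⟩ := hmp p hp
      have hpp := (Nat.mem_primesLE.1 hp)
      have hp2 : (2 : ℝ) ≤ p := by exact_mod_cast hpp.2.two_le
      have hp0 : (0 : ℝ) < p := by linarith
      have hlp : 0 ≤ Real.log p := Real.log_nonneg (by linarith)
      rw [abs_mul, abs_of_nonneg hlp]
      have hkey : |((Nat.smoothNumbersUpTo ⌊x / p⌋₊ (y + 1)).card : ℝ) - x / p * dickmanRho (u - Real.log p / L)| ≤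
          (if p ∈ P₁ then B₁ else B₂) * (x / p * dickmanRho (u - Real.log p / L)) := by
        split_ifs with h1
        · have := IH1 (x / p) hyp hp2x
          rwa [hρp] at this
        · have hpsq : x / p ≤ x / Real.sqrt y := by
            refine div_le_div_of_nonneg_left hx0.le (Real.sqrt_pos.2 hy0) ?_
            rw [hP₁, Nat.mem_primesLE, not_and'] at h1
            have := not_le.1 (h1 hpp.2)
            have := Nat.lt_of_floor_lt this
            exact this.le
          have := IH2 (x / p) hyp hpsq
          rwa [hρp] at this
      calc Real.log p * |((Nat.smoothNumbersUpTo ⌊x / p⌋₊ (y + 1)).card : ℝ) - x / p * dickmanRho (u - Real.log p / L)|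
          ≤ Real.log p * ((if p ∈ P₁ then B₁ else B₂) * (x / p * dickmanRho (u - Real.log p / L))) :=
            mul_le_mul_of_nonneg_left hkey hlp
        _ = x * ((if p ∈ P₁ then B₁ else B₂) * w p) := by simp only [hw]; ring
    calc |E| ≤ ∑ p ∈ Nat.primesLE y, |Real.log p *
          (((Nat.smoothNumbersUpTo ⌊x / p⌋₊ (y + 1)).card : ℝ) - x / p * dickmanRho (u - Real.log p / L))| :=
          Finset.abs_sum_le_sum_abs _ _
      _ ≤ ∑ p ∈ Nat.primesLE y, x * ((if p ∈ P₁ then B₁ else B₂) * w p) := Finset.sum_le_sum hpt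
      _ = x * (B₁ * W₁ + B₂ * ∑ p ∈ Nat.primesLE y \ P₁, w p) := by
          rw [← Finset.mul_sum, ← Finset.sum_sdiff hsub]
          congr 1
          have e1 : ∑ p ∈ P₁, (if p ∈ P₁ then B₁ else B₂) * w p = B₁ * W₁ := by
            rw [hW₁, Finset.mul_sum]
            exact Finset.sum_congr rfl fun p hp => by rw [if_pos hp]
          have e2 : ∑ p ∈ Nat.primesLE y \ P₁, (if p ∈ P₁ then B₁ else B₂) * w p =
              B₂ * ∑ p ∈ Nat.primesLE y \ P₁, w p := by
            rw [Finset.mul_sum]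
            exact Finset.sum_congr rfl fun p hp => by rw [if_neg (Finset.mem_sdiff.1 hp).2]
          rw [e1, e2, add_comm]
  -- bounds for `x W` and `|E|` in terms of `M₀`
  have hβ0 : 0 ≤ B₁ - B₂ := by linarith
  have hxW_up : x * W ≤ M₀ * (u * L) + 4 * CW * u ^ 2 * M₀ := by
    have h1 : W ≤ u * ρu * L + CW * dickmanRho (u - 1) := by linarith [(abs_le.1 hWabs).2]
    have h2 : CW * dickmanRho (u - 1) ≤ CW * (4 * u ^ 2 * ρu) := mul_le_mul_of_nonneg_left hρ1 hCW0
    calc x * W ≤ x * (u * ρu * L + CW * (4 * u ^ 2 * ρu)) := mul_le_mul_of_nonneg_left (by linarith) hx0.le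
      _ = M₀ * (u * L) + 4 * CW * u ^ 2 * M₀ := by rw [hM₀]; ring
  have hxW_lo : M₀ * (u * L) - 4 * CW * u ^ 2 * M₀ ≤ x * W := by
    have h1 : u * ρu * L - CW * dickmanRho (u - 1) ≤ W := by linarith [(abs_le.1 hWabs).1]
    have h2 : CW * dickmanRho (u - 1) ≤ CW * (4 * u ^ 2 * ρu) := mul_le_mul_of_nonneg_left hρ1 hCW0
    calc M₀ * (u * L) - 4 * CW * u ^ 2 * M₀ = x * (u * ρu * L - CW * (4 * u ^ 2 * ρu)) := by rw [hM₀]; ring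
      _ ≤ x * W := mul_le_mul_of_nonneg_left (by linarith) hx0.le
  have hE_up : |E| ≤ M₀ * (u * L) * ((B₁ + B₂) / 2) + (4 * CV + 4 * CW) * u ^ 2 * M₀ := by
    have h1 : B₁ * W₁ + B₂ * ∑ p ∈ Nat.primesLE y \ P₁, w p = (B₁ - B₂) * W₁ + B₂ * W := by
      rw [hWsplit]; ring
    have h2 : (B₁ - B₂) * W₁ ≤ (B₁ - B₂) * (u * ρu * L / 2 + CV * (4 * u ^ 2 * ρu)) := by
      refine mul_le_mul_of_nonneg_left (hW₁b.trans ?_) hβ0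
      linarith [mul_le_mul_of_nonneg_left hρ1 hCV0]
    have h3 : B₂ * W ≤ B₂ * (u * ρu * L + CW * (4 * u ^ 2 * ρu)) := by
      refine mul_le_mul_of_nonneg_left ?_ hB₂
      linarith [(abs_le.1 hWabs).2, mul_le_mul_of_nonneg_left hρ1 hCW0]
    have h4 : (B₁ - B₂) * (CV * (4 * u ^ 2 * ρu)) ≤ 1 * (CV * (4 * u ^ 2 * ρu)) :=
      mul_le_mul_of_nonneg_right (by linarith) (by positivity)
    have h5 : B₂ * (CW * (4 * u ^ 2 * ρu)) ≤ 1 * (CW * (4 * u ^ 2 * ρu)) :=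
      mul_le_mul_of_nonneg_right (by linarith) (by positivity)
    rw [h1] at hEabs
    refine hEabs.trans ?_
    have h6 : (B₁ - B₂) * W₁ + B₂ * W ≤ ρu * (u * L * ((B₁ + B₂) / 2) + (4 * CV + 4 * CW) * u ^ 2) := by
      linarith [h2, h3, h4, h5]
    calc x * ((B₁ - B₂) * W₁ + B₂ * W) ≤ x * (ρu * (u * L * ((B₁ + B₂) / 2) + (4 * CV + 4 * CW) * u ^ 2)) :=
          mul_le_mul_of_nonneg_left h6 hx0.le
      _ = M₀ * (u * L) * ((B₁ + B₂) / 2) + (4 * CV + 4 * CW) * u ^ 2 * M₀ := by rw [hM₀]; ring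
  -- the two chains
  set β := (B₁ + B₂) / 2 with hβ
  have hβ01 : 0 ≤ β ∧ β ≤ 1 := ⟨by rw [hβ]; linarith, by rw [hβ]; linarith⟩
  have hUpper : Ψx * (u * L - 1) ≤ M₀ * (u * L * (1 + β) + (160 + 8 * CW + 4 * CV) * u ^ 2) := by
    have h1 : Ψx * Real.log x ≤ Ψx + ∑ k ∈ Finset.Icc 1 ⌊Real.log x⌋₊,
        ((Nat.smoothNumbersUpTo ⌊x / Real.exp k⌋₊ (y + 1)).card : ℝ) +
        (∑ p ∈ Nat.primesLE y, Real.log p * ((Nat.smoothNumbersUpTo ⌊x / p⌋₊ (y + 1)).card : ℝ) +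
          ∑ p ∈ Nat.primesLE y, ∑ m ∈ Finset.Icc 2 ⌊Real.log x / Real.log 2⌋₊,
            Real.log p * ((Nat.smoothNumbersUpTo ⌊x / (p : ℝ) ^ m⌋₊ (y + 1)).card : ℝ)) := by
      rw [hΨx, hId]; linarith
    rw [hBsum] at h1
    have hE1 := le_abs_self E
    have e : Ψx * Real.log x = Ψx * (u * L) := by rw [hlogx]
    linarith [h1, hA1b, hPb, hxW_up, hE_up, hE1, e]
  have hLower : M₀ * (u * L * (1 - β) - (8 * CW + 4 * CV) * u ^ 2) ≤ Ψx * (u * L) := by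
    have h1 : ∑ p ∈ Nat.primesLE y, Real.log p * ((Nat.smoothNumbersUpTo ⌊x / p⌋₊ (y + 1)).card : ℝ) ≤
        Ψx * Real.log x := by rw [hΨx, hId]; linarith
    rw [hBsum, hlogx] at h1
    have hE1 := neg_abs_le E
    linarith [h1, hxW_lo, hE_up, hE1]
  -- conclude
  have hCu : (166 + 8 * CW + 4 * CV) * u / L ≤ 1 := by
    rw [div_le_one hL0]; exact hsmall
  have hup : Ψx - M₀ ≤ M₀ * (β + (166 + 8 * CW + 4 * CV) * u / L) := by
    -- `M₀ (uL(1+β) + c₂ u²) ≤ M₀ (1 + β + C u/L)(uL - 1)`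
    have hu4 : 4 < u ^ 2 := by nlinarith
    have hpoly : u * L * (1 + β) + (160 + 8 * CW + 4 * CV) * u ^ 2 ≤
        (1 + β + (166 + 8 * CW + 4 * CV) * u / L) * (u * L - 1) := by
      have e1 : (166 + 8 * CW + 4 * CV) * u / L * (u * L) = (166 + 8 * CW + 4 * CV) * u ^ 2 := by
        field_simp
      have e2 : (1 + β + (166 + 8 * CW + 4 * CV) * u / L) * (u * L - 1) =
          u * L * (1 + β) + (166 + 8 * CW + 4 * CV) * u ^ 2 - (1 + β) - (166 + 8 * CW + 4 * CV) * u / L := by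
        rw [← e1]; ring
      rw [e2]
      linarith [hβ01.2, hCu, hu4]
    have h2 : Ψx * (u * L - 1) ≤ M₀ * (1 + β + (166 + 8 * CW + 4 * CV) * u / L) * (u * L - 1) := by
      calc Ψx * (u * L - 1) ≤ M₀ * (u * L * (1 + β) + (160 + 8 * CW + 4 * CV) * u ^ 2) := hUpper
        _ ≤ M₀ * ((1 + β + (166 + 8 * CW + 4 * CV) * u / L) * (u * L - 1)) :=
            mul_le_mul_of_nonneg_left hpoly hM₀0.le
        _ = _ := by ring
    have h3 := le_of_mul_le_mul_right h2 (by linarith)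
    linarith
  have hlo : M₀ - Ψx ≤ M₀ * (β + (166 + 8 * CW + 4 * CV) * u / L) := by
    have h2 : M₀ * (1 - β - (8 * CW + 4 * CV) * u / L) * (u * L) ≤ Ψx * (u * L) := by
      have e1 : M₀ * (1 - β - (8 * CW + 4 * CV) * u / L) * (u * L) = M₀ * (u * L * (1 - β) - (8 * CW + 4 * CV) * u ^ 2) := by
        field_simp
      rw [e1]; exact hLower
    have h3 := le_of_mul_le_mul_right h2 (by positivity)
    have h4 : M₀ * ((8 * CW + 4 * CV) * u / L) ≤ M₀ * ((166 + 8 * CW + 4 * CV) * u / L) := by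
      refine mul_le_mul_of_nonneg_left ?_ hM₀0.le
      refine div_le_div_of_nonneg_right ?_ hL0.le
      nlinarith
    linarith [h3, h4]
  rw [abs_le]
  constructor <;> linarith [hup, hlo]

end HildebrandInduction

end Literature.NumberTheory.Sieve

end
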